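import Literature.NumberTheory.LFunctions.WeilTwoPrimeOddMarginHBase
import Literature.NumberTheory.LFunctions.WeilBlockRowsPZ
import HarnessLib

/-!
# Two-prime odd-margin certificate H: the factored inverse agrees with `D`, rows 24–27

`WeilCert.checkDnRow` for certificate H, by `decide +kernel`. Pure proof file.
-/

noncomputable section

namespace Literature.NumberTheory.LFunctions

set_option maxHeartbeats 0 in
/-- Row 24 of `Dn/Ls` is row 24 of `D` (certificate H). [folklore] -/
theorem checkDnRow1_24_weilCert23H : weilCert23HBase.checkDnRow weilCert23HDn weilCert23HLs 1 24 = true := by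
  decide +kernel

set_option maxHeartbeats 0 in
/-- Row 25 of `Dn/Ls` is row 25 of `D` (certificate H). [folklore] -/
theorem checkDnRow1_25_weilCert23H : weilCert23HBase.checkDnRow weilCert23HDn weilCert23HLs 1 25 = true := by
  decide +kernel

set_option maxHeartbeats 0 in
/-- Row 26 of `Dn/Ls` is row 26 of `D` (certificate H). [folklore] -/
theorem checkDnRow1_26_weilCert23H : weilCert23HBase.checkDnRow weilCert23HDn weilCert23HLs 1 26 = true := by
  decide +kernel

set_option maxHeartbeats 0 in
/-- Row 27 of `Dn/Ls` is row 27 of `D` (certificate H). [folklore] -/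
theorem checkDnRow1_27_weilCert23H : weilCert23HBase.checkDnRow weilCert23HDn weilCert23HLs 1 27 = true := by
  decide +kernel


end Literature.NumberTheory.LFunctions
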